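import Summits.AtomisticToContinuum.HydrodynamicLimit.Theses.EulerCharacteristics
import Summits.AtomisticToContinuum.HydrodynamicLimit.Theorems.EulerCharacteristicsExpTailBudgetRecord
import Literature.MathematicalPhysics.KineticTheory.HardSphereEulerLLN
import Literature.Analysis.FluidPDE.HardSphereAlexander

/-!
# Refutation of `EulerCharacteristics.ExpTailBudget` (stmt-AtomisticToContinuum-14607) [refuted-misstated]

The crux bounds, in EXPONENTIAL currency `exp(-c(N+1))`, the local-Gibbs probability that at some `r ∈ [0, t]`
the CUBIC velocity tail `(N+1)⁻¹ ∑ᵢ (1 + |vᵢ|³) 1(|vᵢ| > A)` exceeds `δ'`.  It is false at `r = 0` already, with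
no dynamics: under the local Gibbs law the velocities are (given the positions) independent Maxwellians, ONE
sphere with `|v₀|³ > (N+1)δ'` makes the cubic tail exceed `δ'`, and a Gaussian outlier of size `R` costs only
`e^{-R²/2θ}`, `R² ≍ ((N+1)δ')^{2/3} = o(N)` (one big jump for the Weibull(2/3)-tailed summands `|v|³`), beating
every `e^{-c(N+1)}`; the Lean proof uses the cruder outlier `R_N² = c(N+1)/2`, of probability `≥ e^{-c(N+1)/2-3}`.
Instance: band `ηb = 1`, constant profiles `(a₀, θ₀, u₀) = (1, 1, 0)`, the constant classical Euler state
`(1, 0, 1)` on `[0, 1)`, Alexander's flows (`HardSphereFlow.nonempty_torus_holds`), the `t = 0` LLN from the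
tree's proved cluster expansion (`localGibbs_lln_holds`, its limit density identified as `ρ₀ ≡ 1` by uniqueness
of limits in probability against the explicit homogeneous expansion `rhoLim`), `t = 0`, `δ' = 1`.
REPAIR (misstated: the witness exploits the cubic WEIGHT, not the dynamics): C′ = `ExpTailBudget` with
`(1 + ‖y.2‖ ^ 3)` replaced by `(1 + ‖y.2‖ ^ 2)` (exponential moments, Cramér-small at `t = 0`; this witness
misses C′); or keep the cubic weight with rate `exp(-c(N+1)^{2/3})`, or a budget in probability (kill criterion
(b)).  The cubic guard of `ExponentialCellProblem`/`FengKurtzTransfer` must be re-matched.  Restricting to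
`r = t > 0` does not help (the homogeneous law is flow-invariant).  refuter-rattack-stmt-AtomisticToContinuum-14607-0.
-/

noncomputable section

open MeasureTheory ProbabilityTheory Filter Set Topology
open scoped ENNReal NNReal
open Literature.MathematicalPhysics.KineticTheory Literature.Analysis.FluidPDE
open Literature.Probability.LatticeModels Literature.MathematicalPhysics.StatisticalMechanics

namespace Summit.AtomisticToContinuum.HydrodynamicLimit.Theorems

/-- One-dimensional standard Gaussian tail from below: `P(R < |y|) ≥ e^{-R² - 3}` (`R ≥ 0`): the
density on `(R, R+1]` is at least `(√(2π))⁻¹ e^{-(R+1)²/2} ≥ e^{-2} e^{-R²-1}`. [folklore] -/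
private theorem ExpTailBudget.gaussianReal_tail_ge {R : ℝ} (hR : 0 ≤ R) :
    ENNReal.ofReal (Real.exp (-R ^ 2 - 3)) ≤ gaussianReal 0 1 {y | R < |y|} := by
  refine le_trans ?_ (measure_mono (show Set.Ioc R (R + 1) ⊆ {y : ℝ | R < |y|} from
    fun y hy => lt_of_lt_of_le hy.1 (le_abs_self y)))
  rw [gaussianReal_apply _ one_ne_zero]
  have hconst : ∫⁻ _ in Set.Ioc R (R + 1), ENNReal.ofReal (Real.exp (-R ^ 2 - 3))
      ∂(volume : Measure ℝ) = ENNReal.ofReal (Real.exp (-R ^ 2 - 3)) := by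
    rw [setLIntegral_const, Real.volume_Ioc, add_sub_cancel_left, ENNReal.ofReal_one, mul_one]
  rw [← hconst]
  refine setLIntegral_mono' measurableSet_Ioc fun y hy => ?_
  rw [gaussianPDF, gaussianPDFReal]
  refine ENNReal.ofReal_le_ofReal ?_
  have hsq : -(y - 0) ^ 2 / (2 * ((1 : ℝ≥0) : ℝ)) ≥ -R ^ 2 - 1 := by
    rw [NNReal.coe_one, mul_one, sub_zero, ge_iff_le]
    have : y ^ 2 ≤ (R + 1) ^ 2 := pow_le_pow_left₀ (hR.trans hy.1.le) hy.2 2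
    nlinarith [sq_nonneg (R - 1)]
  have hsqrt_pos : 0 < Real.sqrt (2 * Real.pi * ((1 : ℝ≥0) : ℝ)) := by
    rw [NNReal.coe_one, mul_one]; exact Real.sqrt_pos.2 (by positivity)
  have hinv : Real.exp (-2) ≤ (Real.sqrt (2 * Real.pi * ((1 : ℝ≥0) : ℝ)))⁻¹ := by
    rw [le_inv_comm₀ (Real.exp_pos _) hsqrt_pos, ← Real.exp_neg, neg_neg]
    have hsqrt : Real.sqrt (2 * Real.pi * ((1 : ℝ≥0) : ℝ)) ≤ 3 := by
      rw [NNReal.coe_one, mul_one, Real.sqrt_le_iff]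
      exact ⟨by norm_num, by nlinarith [Real.pi_le_four]⟩
    linarith [Real.add_one_le_exp (2 : ℝ)]
  calc Real.exp (-R ^ 2 - 3) = Real.exp (-2) * Real.exp (-R ^ 2 - 1) := by
        rw [show (-R ^ 2 - 3 : ℝ) = -2 + (-R ^ 2 - 1) by ring, Real.exp_add]
    _ ≤ (Real.sqrt (2 * Real.pi * ((1 : ℝ≥0) : ℝ)))⁻¹ * Real.exp (-(y - 0) ^ 2 / (2 * ((1 : ℝ≥0) : ℝ))) := by
        gcongr

/-- Standard Gaussian on `ℝ³`: `P(R < ‖w‖) ≥ e^{-R²-3}` (`R ≥ 0`), via the first coordinate. [folklore] -/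
private theorem ExpTailBudget.stdGaussian_tail_ge {R : ℝ} (hR : 0 ≤ R) :
    ENNReal.ofReal (Real.exp (-R ^ 2 - 3)) ≤ stdGaussian V3 {w | R < ‖w‖} := by
  refine le_trans ?_ (measure_mono (show {w : V3 | R < |w 0|} ⊆ {w | R < ‖w‖} from
    fun w hw => lt_of_lt_of_le hw (by simpa using PiLp.norm_apply_le w 0)))
  have hm : MeasurableSet {w : V3 | R < |w 0|} := measurableSet_lt measurable_const (by fun_prop)
  rw [← map_pi_eq_stdGaussian, Measure.map_apply (WithLp.measurable_toLp 2 _) hm]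
  have hpre : (WithLp.toLp 2) ⁻¹' {w : V3 | R < |w 0|} =
      (Function.eval (0 : Fin 3)) ⁻¹' {y : ℝ | R < |y|} := by ext x; simp
  rw [hpre, (measurePreserving_eval (fun _ : Fin 3 => gaussianReal 0 1) 0).measure_preimage
    (measurableSet_lt measurable_const (by fun_prop)).nullMeasurableSet]
  exact ExpTailBudget.gaussianReal_tail_ge hR

/-- Gaussian velocity tail of the homogeneous local Gibbs law (`σ ≤ 1/2`, any `N`, any flow, `R ≥ 0`):
`LG {z | R < ‖v₀(z)‖} ≥ e^{-R²-3}` — positions and velocities are independent and `v₀ ∼ N(0, I₃)`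
(disintegration `lintegral_localGibbsMeasure`). [folklore] -/
private theorem ExpTailBudget.localGibbsLaw_tail_ge {σ : ℝ} (hσ2 : σ ≤ 1 / 2) (N : ℕ)
    (Φ : HardSphereFlow (Torus.geometry (Fin 3)) (hsDiameter σ N) (N + 1)) {R : ℝ} (hR : 0 ≤ R) :
    ENNReal.ofReal (Real.exp (-R ^ 2 - 3)) ≤
      localGibbsLaw σ (fun _ => 1) (fun _ => 0) (fun _ => 1) N Φ {z | R < ‖(z 0).2‖} := by
  have ha : Continuous (fun _ : T3 => (1 : ℝ)) := continuous_const
  have hu : Continuous (fun _ : T3 => (0 : V3)) := continuous_const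
  haveI := isProbabilityMeasure_localGibbsMeasure (u₀ := fun _ => (0 : V3)) ha ha hu
    (fun _ => one_pos) (fun _ => one_pos) hσ2 N
  set S : Set (Config (N + 1) (Fin 3) T3) := {z | R < ‖(z 0).2‖} with hS
  have hSm : MeasurableSet S := measurableSet_lt measurable_const (measurable_pi_apply 0).snd.norm
  have hT : MeasurableSet {v : Fin (N + 1) → V3 | R < ‖v 0‖} :=
    measurableSet_lt measurable_const (measurable_pi_apply 0).norm
  have hW : MeasurableSet {w : V3 | R < ‖w‖} := measurableSet_lt measurable_const measurable_norm
  rw [localGibbsLaw_eq, ← lintegral_indicator_one hSm,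
    lintegral_localGibbsMeasure ha ha hu (fun _ => zero_le_one) (fun _ => one_pos) σ N
      (measurable_one.indicator hSm)]
  have hinner : ∀ x : Fin (N + 1) → T3,
      ∫⁻ v, S.indicator 1 (zipConfig (x, v)) ∂velMeasure (fun _ => (0 : V3)) (fun _ => (1 : ℝ)) x
        = gaussMeasure (0 : V3) 1 {w | R < ‖w‖} := by
    intro x
    have hind : ∀ v : Fin (N + 1) → V3, S.indicator (1 : Config (N + 1) (Fin 3) T3 → ℝ≥0∞)
        (zipConfig (x, v)) = {v : Fin (N + 1) → V3 | R < ‖v 0‖}.indicator 1 v := by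
      intro v
      by_cases hv : R < ‖v 0‖
      · rw [Set.indicator_of_mem (show zipConfig (x, v) ∈ S by simpa [hS] using hv),
          Set.indicator_of_mem (show v ∈ {v : Fin (N + 1) → V3 | R < ‖v 0‖} from hv)]
        rfl
      · rw [Set.indicator_of_notMem (show zipConfig (x, v) ∉ S by simpa [hS] using hv),
          Set.indicator_of_notMem (show v ∉ {v : Fin (N + 1) → V3 | R < ‖v 0‖} from hv)]
    simp_rw [hind]
    rw [lintegral_indicator_one hT]
    exact (measurePreserving_eval (fun _ : Fin (N + 1) => gaussMeasure (0 : V3) 1) 0).measure_preimage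
      hW.nullMeasurableSet
  simp_rw [hinner]
  have hρm : Measurable fun x : Fin (N + 1) → T3 => ENNReal.ofReal
      ((canonicalPartition (Torus.geometry (Fin 3)) (hsDiameter σ N) (N + 1)
        (localGibbsProfile (fun _ => 1) (fun _ => (0 : V3)) (fun _ => 1)))⁻¹ *
        posWeight (fun _ => 1) (hsDiameter σ N) (N + 1) x) :=
    (measurable_const.mul (measurable_posWeight ha _ _)).ennreal_ofReal
  rw [lintegral_mul_const _ hρm,
    lintegral_posWeight_eq_one ha ha hu (fun _ => zero_le_one) (fun _ => one_pos) σ N, one_mul,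
    gaussMeasure, Measure.map_apply (measurable_gaussShift _ _) hW]
  rw [show (fun w : V3 => (0 : V3) + Real.sqrt 1 • w) ⁻¹' {w | R < ‖w‖} = {w | R < ‖w‖} by ext w; simp]
  exact ExpTailBudget.stdGaussian_tail_ge hR

/-- Density LLN of the homogeneous canonical hard-sphere gas with an EXPLICIT constant limit `κ` (the
proof of the tree's `localGibbs_densityLLN_holds` for `a₀ ≡ 1`, keeping `ρ₀ = rhoLim` explicit: it is
constant because `β ≡ 1`). [folklore] -/
private theorem ExpTailBudget.densityLLN_const :
    ∃ σ₀ : ℝ, 0 < σ₀ ∧ ∀ σ : ℝ, 0 < σ → σ < σ₀ → ∃ κ : ℝ, ∀ χ : T3 → ℝ, Continuous χ → ∀ δ > (0 : ℝ),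
      Tendsto (fun N : ℕ => posGibbsMeasure (fun _ : T3 => (1 : ℝ)) (hsDiameter σ N) (N + 1)
        {x | δ < |((N + 1 : ℕ) : ℝ)⁻¹ * ∑ i, χ (x i) - ∫ y, χ y * κ|}) atTop (𝓝 0) := by
  have ha : Continuous (fun _ : T3 => (1 : ℝ)) := continuous_const
  have ha0 : ∀ x : T3, (0 : ℝ) < (fun _ : T3 => (1 : ℝ)) x := fun _ => one_pos
  set P := profileOf (fun _ : T3 => (1 : ℝ)) ha ha0 with hP
  obtain ⟨σ₀, hσ₀, hsmall⟩ := exists_smallDensity P (P.pos 0)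
  refine ⟨σ₀, hσ₀, fun σ hσ hσσ₀ => ?_⟩
  obtain ⟨h, -⟩ := hsmall σ hσ hσσ₀
  refine ⟨rhoLim P σ 0, fun χ hχ δ hδ => ?_⟩
  have hconst : ∀ y, rhoLim P σ y = rhoLim P σ 0 := fun y => by simp only [rhoLim, hP, profileOf_β]
  have hIeq : ∫ y, χ y * rhoLim P σ 0 = Ilim P σ χ := by
    rw [h.Ilim_eq_integral hχ]
    exact integral_congr_ae (ae_of_all _ fun y => by
      show χ y * rhoLim P σ 0 = χ y * rhoLim P σ y
      rw [hconst y])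
  rw [hIeq]
  obtain ⟨C, hC0, hχC⟩ := exists_forall_abs_le_of_continuous hχ
  have hχm : Measurable χ := hχ.measurable
  set I := Ilim P σ χ with hI
  set V : ℕ → ℝ := fun N => (∫ x, ((((N + 1 : ℕ) : ℝ))⁻¹ * ∑ i, χ (x i) - I) ^ 2 *
      efR (Ov (hsDiameter σ N)) x Finset.univ ∂Measure.pi (fun _ : Fin (N + 1) => P.μ)) / XiN P σ N (N + 1)
    with hV
  have hbound : ∀ N : ℕ, posGibbsMeasure (fun _ : T3 => (1 : ℝ)) (hsDiameter σ N) (N + 1)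
      {x | δ < |((N + 1 : ℕ) : ℝ)⁻¹ * ∑ i, χ (x i) - I|} ≤ ENNReal.ofReal (V N / δ ^ 2) := by
    intro N
    have hXi := XiN_pos h.σ_pos.le h.σ_lt_half h.ovDensity_lt_one (N := N) (m := N + 1) le_rfl
    have hA : Measurable fun x : Fin (N + 1) → T3 => ((N + 1 : ℕ) : ℝ)⁻¹ * ∑ i, χ (x i) :=
      (Finset.measurable_sum _ fun i _ => hχm.comp (measurable_pi_apply i)).const_mul _
    have hAK : ∀ x : Fin (N + 1) → T3, |((N + 1 : ℕ) : ℝ)⁻¹ * ∑ i, χ (x i)| ≤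
        ((N + 1 : ℕ) : ℝ)⁻¹ * ((N + 1 : ℕ) * C) := fun x => by
      rw [abs_mul, abs_of_nonneg (by positivity)]
      exact mul_le_mul_of_nonneg_left (abs_sum_apply_le hχC x) (by positivity)
    rw [posGibbsMeasure_eq ha ha0, Measure.smul_apply, smul_eq_mul]
    refine (mul_le_mul_right (restrict_hardCore_deviation_le P _ _ hA hAK I hδ) _).trans (le_of_eq ?_)
    have hXi' : 0 ≤ (Xi P (hsDiameter σ N) (N + 1) (N + 1))⁻¹ := inv_nonneg.2 hXi.le
    rw [← ENNReal.ofReal_mul hXi']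
    congr 1
    rw [hV]
    dsimp only
    rw [XiN, inv_mul_eq_div, div_div, div_div, mul_comm]
  have hlim : Tendsto (fun N => ENNReal.ofReal (V N / δ ^ 2)) atTop (𝓝 0) := by
    have := ENNReal.tendsto_ofReal ((h.tendsto_variance hχ).div_const (δ ^ 2))
    rwa [zero_div, ENNReal.ofReal_zero] at this
  exact tendsto_of_tendsto_of_tendsto_of_le_of_le tendsto_const_nhds hlim (fun _ => zero_le) hbound

/-- The constant limit density is `1` (test `χ ≡ 1`: the empirical density is identically `1` and the
configurational Gibbs measures are probability measures for `σ ≤ 1/2`). [folklore] -/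
private theorem ExpTailBudget.kappa_eq_one {σ : ℝ} (hσ2 : σ ≤ 1 / 2) {κ : ℝ}
    (hd : ∀ χ : T3 → ℝ, Continuous χ → ∀ δ > (0 : ℝ),
      Tendsto (fun N : ℕ => posGibbsMeasure (fun _ : T3 => (1 : ℝ)) (hsDiameter σ N) (N + 1)
        {x | δ < |((N + 1 : ℕ) : ℝ)⁻¹ * ∑ i, χ (x i) - ∫ y, χ y * κ|}) atTop (𝓝 0)) : κ = 1 := by
  by_contra hne
  have hk : 0 < |1 - κ| := abs_pos.2 (sub_ne_zero.2 (Ne.symm hne))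
  have h := hd (fun _ => 1) continuous_const (|1 - κ| / 2) (by positivity)
  have hint : ∫ y : T3, (fun _ : T3 => (1 : ℝ)) y * κ = κ := by simp
  have huniv : ∀ N : ℕ, {x : Fin (N + 1) → T3 | |1 - κ| / 2 <
      |((N + 1 : ℕ) : ℝ)⁻¹ * ∑ i : Fin (N + 1), (fun _ : T3 => (1 : ℝ)) (x i) -
        ∫ y : T3, (fun _ : T3 => (1 : ℝ)) y * κ|} = Set.univ := by
    intro N
    refine Set.eq_univ_of_forall fun x => ?_
    rw [Set.mem_setOf_eq, hint]
    have hsum : ((N + 1 : ℕ) : ℝ)⁻¹ * ∑ _i : Fin (N + 1), (fun _ : T3 => (1 : ℝ)) (x _i) = 1 := by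
      simp only [Finset.sum_const, Finset.card_univ, Fintype.card_fin, nsmul_eq_mul, mul_one]
      exact inv_mul_cancel₀ (by positivity)
    rw [hsum]
    linarith
  have h1 : Tendsto (fun _ : ℕ => (1 : ℝ≥0∞)) atTop (𝓝 0) := by
    refine h.congr fun N => ?_
    haveI := isProbabilityMeasure_posGibbsMeasure (a₀ := fun _ : T3 => (1 : ℝ)) continuous_const
      (fun _ => one_pos) hσ2 N
    rw [huniv N, measure_univ]
  exact one_ne_zero (tendsto_const_nhds_iff.1 h1)

/-- Limits in probability are unique (probability measures). [folklore] -/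
private theorem ExpTailBudget.limit_unique {Ω : ℕ → Type*} [∀ N, MeasurableSpace (Ω N)]
    {P : (N : ℕ) → Measure (Ω N)} (hP : ∀ N, P N Set.univ = 1) {F : (N : ℕ) → Ω N → ℝ} {a b : ℝ}
    (ha : ∀ δ > (0 : ℝ), Tendsto (fun N => P N {z | δ < |F N z - a|}) atTop (𝓝 0))
    (hb : ∀ δ > (0 : ℝ), Tendsto (fun N => P N {z | δ < |F N z - b|}) atTop (𝓝 0)) : a = b := by
  by_contra hne
  have hab : 0 < |a - b| := abs_pos.2 (sub_ne_zero.2 hne)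
  have hle : ∀ N, (1 : ℝ≥0∞) ≤
      P N {z | |a - b| / 3 < |F N z - a|} + P N {z | |a - b| / 3 < |F N z - b|} := by
    intro N
    rw [← hP N]
    refine (measure_mono fun z _ => ?_).trans (measure_union_le _ _)
    by_contra hz
    simp only [Set.mem_union, Set.mem_setOf_eq, not_or, not_lt] at hz
    have h1 : |a - b| ≤ |F N z - a| + |F N z - b| := by
      calc |a - b| = |(F N z - b) - (F N z - a)| := by ring_nf
        _ ≤ |F N z - b| + |F N z - a| := abs_sub _ _
        _ = |F N z - a| + |F N z - b| := add_comm _ _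
    linarith [hz.1, hz.2]
  have h0 : Tendsto (fun N => P N {z | |a - b| / 3 < |F N z - a|} +
      P N {z | |a - b| / 3 < |F N z - b|}) atTop (𝓝 0) := by
    simpa using (ha _ (by positivity)).add (hb _ (by positivity))
  exact absurd (ge_of_tendsto' h0 hle) (by simp)

/-- A continuous function on `𝕋³` integrating like `1` against every continuous test is `1`. [folklore] -/
private theorem ExpTailBudget.eq_one_of_integral {ρ₀ : T3 → ℝ} (hρ : Continuous ρ₀)
    (h : ∀ χ : T3 → ℝ, Continuous χ → ∫ y, χ y * ρ₀ y = ∫ y, χ y * 1) : ρ₀ = fun _ => 1 := by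
  have hint : ∫ y, (ρ₀ y - 1) ^ 2 = 0 := by
    have hsq : (fun y => (ρ₀ y - 1) ^ 2) = fun y => (ρ₀ y - 1) * ρ₀ y - (ρ₀ y - 1) * 1 := by
      funext y; ring
    rw [hsq, integral_sub (integrable_of_continuous_T3 (by fun_prop))
      (integrable_of_continuous_T3 (by fun_prop)), h (fun y => ρ₀ y - 1) (hρ.sub continuous_const),
      sub_self]
  have hae := (integral_eq_zero_iff_of_nonneg (fun y => sq_nonneg (ρ₀ y - 1))
    (integrable_of_continuous_T3 (by fun_prop))).1 hint
  have heq : (fun y => (ρ₀ y - 1) ^ 2) = (fun _ => (0 : ℝ)) :=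
    (Continuous.ae_eq_iff_eq volume (by fun_prop) continuous_const).1 hae
  funext y
  have hy := congr_fun heq y
  simp only [ne_eq, OfNat.ofNat_ne_zero, not_false_eq_true, pow_eq_zero_iff] at hy
  linarith

/-- The homogeneous unit local Gibbs state satisfies the `t = 0` law of large numbers with limits
`(1, 0, 3/2)`: the tree's `localGibbs_lln_holds`, its limit density identified as `ρ₀ ≡ 1` by uniqueness
of limits in probability against `densityLLN_const`/`kappa_eq_one`. [folklore] -/
private theorem ExpTailBudget.homogeneousLLN :
    ∃ σ₁ : ℝ, 0 < σ₁ ∧ ∀ σ : ℝ, 0 < σ → σ < σ₁ →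
      ∀ Φ : (N : ℕ) → HardSphereFlow (Torus.geometry (Fin 3)) (hsDiameter σ N) (N + 1),
        TendstoHydroFieldsAt (fun N => localGibbsLaw σ (fun _ => 1) (fun _ => 0) (fun _ => 1) N (Φ N)) Φ
          (fun _ _ => 1) (fun _ _ => 0) (fun _ _ => 1) 0 := by
  have ha : Continuous (fun _ : T3 => (1 : ℝ)) := continuous_const
  have hu : Continuous (fun _ : T3 => (0 : V3)) := continuous_const
  obtain ⟨σ₀, hσ₀, hσ⟩ := ExpTailBudget.densityLLN_const
  obtain ⟨σ₀', hσ₀', hσ'⟩ := localGibbs_lln_holds (fun _ => 1) (fun _ => 1) (fun _ => 0) ha ha hu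
    (fun _ => one_pos) (fun _ => one_pos)
  refine ⟨min (min σ₀ σ₀') (1 / 2), by positivity, fun σ hσpos hσlt Φ => ?_⟩
  have hσ1 : σ < σ₀ := lt_of_lt_of_le hσlt ((min_le_left _ _).trans (min_le_left _ _))
  have hσ1' : σ < σ₀' := lt_of_lt_of_le hσlt ((min_le_left _ _).trans (min_le_right _ _))
  have hσ2 : σ ≤ 1 / 2 := (lt_of_lt_of_le hσlt (min_le_right _ _)).le
  obtain ⟨κ, hd⟩ := hσ σ hσpos hσ1
  have hκ : κ = 1 := ExpTailBudget.kappa_eq_one hσ2 hd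
  subst hκ
  obtain ⟨ρ₀, hρc, -, hlln⟩ := hσ' σ hσpos hσ1'
  obtain ⟨-, hT⟩ := hlln Φ
  have hρ : ρ₀ = fun _ => 1 := by
    refine ExpTailBudget.eq_one_of_integral hρc fun χ hχ => ?_
    refine ExpTailBudget.limit_unique
      (P := fun N => localGibbsMeasure σ (fun _ => 1) (fun _ => 0) (fun _ => 1) N)
      (fun N => ?_) (F := fun N z => empiricalDensityField z χ) (fun δ hδ => ?_) (fun δ hδ => ?_)
    · haveI := isProbabilityMeasure_localGibbsMeasure (u₀ := fun _ => (0 : V3)) ha ha hu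
        (fun _ => one_pos) (fun _ => one_pos) hσ2 N
      exact measure_univ
    · exact ((hT χ hχ δ hδ).1).congr fun N => localGibbsLaw_preimage_flow_zero σ _ _ _ N (Φ N)
        {w | δ < |empiricalDensityField w χ - ∫ x, χ x * ρ₀ x|}
    · refine (tendsto_localGibbsMeasure_densityEvent (u₀ := fun _ => (0 : V3)) (ρ₀ := fun _ => 1)
        ha ha hu (fun _ => zero_le_one) (fun _ => one_pos) σ hd hχ hδ).congr fun N => ?_
      simp only [empiricalDensityField_eq_sum]
  subst hρ
  exact hT

/-- The constant state `(ρ, u, θ) = (1, 0, 1)` is a classical hard-sphere Euler solution on `[0, T)` for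
every `σ, T` (all derivatives vanish). [folklore] -/
private theorem ExpTailBudget.constState_isSolution (σ T : ℝ) :
    IsHardSphereEulerSolution σ T (fun _ _ => 1) (fun _ _ => 0) (fun _ _ => 1) := by
  have hg : ∀ x : T3, Literature.Analysis.FunctionSpaces.Torus.gradient
      (fun _ : T3 => hsPressure σ 1 1) x = 0 := fun x => by
    unfold Literature.Analysis.FunctionSpaces.Torus.gradient Literature.Analysis.FunctionSpaces.Torus.liftAt
    simp [_root_.gradient]
  refine ⟨contDiffOn_const, contDiffOn_const, contDiffOn_const, fun _ _ _ => one_pos,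
    fun _ _ _ => one_pos, ?_, ?_, ?_⟩ <;> intro t _ x <;>
    simp [Literature.Analysis.FunctionSpaces.Torus.timeDerivWithin,
      Literature.Analysis.FunctionSpaces.Torus.divergence,
      Literature.Analysis.FunctionSpaces.Torus.partialDeriv,
      Literature.Analysis.FunctionSpaces.Torus.lineDeriv, hg]

/-- One fast sphere already violates the cubic tail guard: if `‖v₀‖ > A` and `‖v₀‖ ^ 3 > N + 1` then
`(N+1)⁻¹ ∑ᵢ (1 + ‖vᵢ‖³) 1(A < ‖vᵢ‖) > 1`. [folklore] -/
private theorem ExpTailBudget.one_lt_cubicTail {N : ℕ} (z : Config (N + 1) (Fin 3) T3) (A : ℝ)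
    (hA : A < ‖(z 0).2‖) (hcube : ((N + 1 : ℕ) : ℝ) < ‖(z 0).2‖ ^ 3) :
    (1 : ℝ) < ∫ y, (1 + ‖y.2‖ ^ 3) * (if A < ‖y.2‖ then (1 : ℝ) else 0) ∂empiricalMeasure z := by
  rw [integral_empiricalMeasure]
  have hterm : ∀ i ∈ (Finset.univ : Finset (Fin (N + 1))),
      0 ≤ (1 + ‖(z i).2‖ ^ 3) * (if A < ‖(z i).2‖ then (1 : ℝ) else 0) := fun i _ => by
    have : (0 : ℝ) ≤ ‖(z i).2‖ ^ 3 := by positivity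
    split_ifs <;> nlinarith
  have h0 := Finset.single_le_sum hterm (Finset.mem_univ 0)
  rw [if_pos hA, mul_one] at h0
  rw [← div_eq_inv_mul, lt_div_iff₀ (by positivity : (0 : ℝ) < ((N + 1 : ℕ) : ℝ)), one_mul]
  linarith

/-- Refutes `EulerCharacteristics.ExpTailBudget` [refuted-misstated]: band `ηb = 1`, constant profiles
`(1, 1, 0)`, the constant Euler state `(1, 0, 1)` on `[0, 1)`, Alexander's flows, the proved `t = 0` LLN,
`t = 0`, `δ' = 1`; for the returned `A, c` and every large `N` the event at `r = 0` contains
`{‖v₀‖ > R_N}`, `R_N² = c(N+1)/2`, of local Gibbs probability `≥ e^{-c(N+1)/2-3} > e^{-c(N+1)}`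
(Maxwellian tail).  Repair: quadratic tail weight (module docstring). [folklore] -/
theorem EulerCharacteristicsExpTailBudget_refuted :
    ¬ Summit.AtomisticToContinuum.HydrodynamicLimit.Theses.EulerCharacteristics.ExpTailBudget := by
  intro h
  obtain ⟨σ₁, hσ₁, hlln⟩ := ExpTailBudget.homogeneousLLN
  obtain ⟨σ₀, hσ₀, hσ⟩ := h 1 one_pos (fun _ => 1) (fun _ => 1) (fun _ => 0)
    continuous_const continuous_const continuous_const (fun _ => one_pos) (fun _ => one_pos)
  obtain ⟨σ, hσpos, hσlt0, hσlt1, hσhalf⟩ : ∃ σ : ℝ, 0 < σ ∧ σ < σ₀ ∧ σ < σ₁ ∧ σ < 2⁻¹ := by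
    refine ⟨min (min σ₀ σ₁) 2⁻¹ / 2, by positivity, ?_, ?_, ?_⟩ <;>
      linarith [min_le_left (min σ₀ σ₁) (2⁻¹ : ℝ), min_le_right (min σ₀ σ₁) (2⁻¹ : ℝ),
        min_le_left σ₀ σ₁, min_le_right σ₀ σ₁, lt_min (lt_min hσ₀ hσ₁) (show (0 : ℝ) < 2⁻¹ by norm_num)]
  have hσhalf' : σ ≤ 1 / 2 := by rw [one_div]; exact hσhalf.le
  let Φ : (N : ℕ) → HardSphereFlow (Torus.geometry (Fin 3)) (hsDiameter σ N) (N + 1) := fun N =>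
    (HardSphereFlow.nonempty_torus_holds (d := Fin 3) (hsDiameter_pos hσpos N)
      (lt_of_le_of_lt (hsDiameter_le hσpos.le N) hσhalf) (N + 1)).some
  have hband : ∀ t ∈ Set.Ico (0 : ℝ) 1, ∀ x : T3, (fun (_ : ℝ) (_ : T3) => (1 : ℝ)) t x * σ ^ 3 < 1 := by
    intro t _ x; have : σ ^ 3 < 1 ^ 3 := by gcongr; linarith
    simpa using this
  obtain ⟨A, hA, c, hc, hev⟩ := hσ σ hσpos hσlt0 1 (fun _ _ => 1) (fun _ _ => 1) (fun _ _ => 0)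
    (ExpTailBudget.constState_isSolution σ 1) hband Φ (hlln σ hσpos hσlt1 Φ) 0 ⟨le_rfl, one_pos⟩ 1 one_pos
  have hT : ∀ᶠ N : ℕ in atTop, (2 * (max A 1) ^ 2 / c < ((N + 1 : ℕ) : ℝ) ∧
      8 / c ^ 3 ≤ ((N + 1 : ℕ) : ℝ)) ∧ 6 / c < ((N + 1 : ℕ) : ℝ) := by
    have h1' := (tendsto_natCast_atTop_atTop (R := ℝ)).comp (tendsto_add_atTop_nat 1)
    exact ((h1'.eventually (eventually_gt_atTop _)).and
      (h1'.eventually (eventually_ge_atTop _))).and (h1'.eventually (eventually_gt_atTop _))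
  have hlow : ∀ᶠ N : ℕ in atTop, ENNReal.ofReal (Real.exp (-(c * (N + 1)))) <
      localGibbsLaw σ (fun _ => 1) (fun _ => 0) (fun _ => 1) N (Φ N) {z | ∃ r ∈ Set.Icc (0 : ℝ) 0, (let ℓ : ℝ := ((N + 1 : ℕ) : ℝ) ^ (-(1 / 4 : ℝ)); let χ : T3 → T3 → ℝ := fun x y => if Torus.euclidDist x y < ℓ then (4 / 3 * Real.pi * ℓ ^ 3)⁻¹ else 0; let ρℓ : T3 → ℝ := fun x => empiricalDensityField ((Φ N).flow r z) (χ x); (1 : ℝ) < ∫ y, (1 + ‖y.2‖ ^ 3) * (if A < ‖y.2‖ then (1 : ℝ) else 0) ∂empiricalMeasure ((Φ N).flow r z) ∨ (1 : ℝ) < ∫ x, (if 2 * (1 : ℝ) < ρℓ x * σ ^ 3 then ρℓ x else 0))} := by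
    filter_upwards [hT] with N hN
    obtain ⟨⟨hN1, hN2⟩, hN3⟩ := hN
    set n : ℝ := ((N + 1 : ℕ) : ℝ) with hndef
    have hn : 0 < n := by rw [hndef]; positivity
    set R : ℝ := Real.sqrt (c * n / 2) with hRdef
    have hR2 : R ^ 2 = c * n / 2 := by rw [hRdef, Real.sq_sqrt]; positivity
    have hRpos : 0 < R := by rw [hRdef]; exact Real.sqrt_pos.2 (by positivity)
    have hM : max A 1 < R := by
      refine lt_of_pow_lt_pow_left₀ 2 hRpos.le ?_
      rw [hR2]
      linarith [(div_lt_iff₀ hc).1 hN1]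
    have hR3 : n ≤ R ^ 3 := by
      have hcR : 2 / c ≤ R := by
        have h4 : (2 / c) ^ 2 ≤ R ^ 2 := by
          rw [hR2]
          have h8 : 8 / c ^ 3 * c = 2 * (2 / c) ^ 2 := by field_simp; ring
          nlinarith [h8]
        exact le_of_pow_le_pow_left₀ (by norm_num) hRpos.le h4
      rw [show R ^ 3 = R * (c * n / 2) by rw [← hR2]; ring]
      have h5 : 2 / c * (c * n / 2) = n := by field_simp
      nlinarith [hcR, h5, hn, hc]
    have hexp : ENNReal.ofReal (Real.exp (-(c * (N + 1)))) < ENNReal.ofReal (Real.exp (-R ^ 2 - 3)) := by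
      rw [ENNReal.ofReal_lt_ofReal_iff (Real.exp_pos _), Real.exp_lt_exp, hR2,
        show (N : ℝ) + 1 = n by rw [hndef]; push_cast; ring]
      linarith [(div_lt_iff₀ hc).1 hN3]
    refine lt_of_lt_of_le hexp (le_trans (ExpTailBudget.localGibbsLaw_tail_ge hσhalf' N (Φ N) hRpos.le) ?_)
    set μ := localGibbsLaw σ (fun _ => 1) (fun _ => 0) (fun _ => 1) N (Φ N) with hμ
    have hgood : μ (Φ N).goodᶜ = 0 := by
      have habs : μ ≪ liouville (Torus.geometry (Fin 3)) (N + 1) (hsDiameter σ N) := by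
        rw [hμ, localGibbsLaw, particleLaw_eq]
        exact withDensity_absolutelyContinuous _ _
      exact habs (Φ N).measure_compl_good
    calc μ {z | R < ‖(z 0).2‖}
        ≤ μ ({z | R < ‖(z 0).2‖} ∩ (Φ N).good) + μ ({z | R < ‖(z 0).2‖} \ (Φ N).good) :=
          measure_le_inter_add_sdiff _ _ _
      _ ≤ μ ({z | R < ‖(z 0).2‖} ∩ (Φ N).good) + μ (Φ N).goodᶜ := by gcongr; exact fun z hz => hz.2
      _ = μ ({z | R < ‖(z 0).2‖} ∩ (Φ N).good) := by rw [hgood, add_zero]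
      _ ≤ _ := by
          refine measure_mono ?_
          rintro z ⟨hz, hzg⟩
          refine ⟨0, ⟨le_rfl, le_rfl⟩, ?_⟩
          simp only []
          left
          rw [(Φ N).flow_zero z hzg]
          refine ExpTailBudget.one_lt_cubicTail z A (lt_trans (lt_of_le_of_lt (le_max_left _ _) hM) hz) ?_
          have hz' : R < ‖(z 0).2‖ := hz
          calc n ≤ R ^ 3 := hR3
            _ < ‖(z 0).2‖ ^ 3 := by gcongr
  obtain ⟨N, hN1, hN2⟩ := (hev.and hlow).exists
  exact absurd (lt_of_lt_of_le hN2 hN1) (lt_irrefl _)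

end Summit.AtomisticToContinuum.HydrodynamicLimit.Theorems

end
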